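import Summits.ValiantsHypothesis.ValiantsHypothesis.Theorems.SymPencilSdcSuperquadraticStubDefectForm
import Summits.ValiantsHypothesis.ValiantsHypothesis.Theorems.SymPencilSdcSuperquadraticStubBlockRankFour
import Summits.ValiantsHypothesis.ValiantsHypothesis.Theorems.SymPencilSdcPerFourWindow

/-!
# Route `SymPencil` — `sdc(per_4) ≥ 21`: five more than the variable count
# (the RUNG of line `box_four` of crux `SdcSuperquadratic`, `--supports` stmt-ValiantsHypothesis-5674)

**Theorem** (`twentyOne_le_of_isSymm_isAffineDetRepr_perPoly_four`).  Over a field of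
characteristic `0`, every SYMMETRIC affine determinantal representation of the `4 × 4` permanent
has size `m ≥ 21 = 4² + 5`.  (Tree before this file: `19`, `SymPencilSdcPerFourNineteen`.)

Proof = the composition of the three stubs of the line `box_four`
(`Cruxes/SdcSuperquadratic/Lines/box_four.lean`, `twentyOne_le_of`), all landed over an arbitrary
field of characteristic `0`:

* `SymPencilSdcSuperquadraticStubDefectForm.defectForm_of_isSymm_isAffineDetRepr_perPoly_four_le`
  (this seat): a representation of size `m ≤ 20` gives an `8`-dimensional `V ⊆ Sing Z(per_4)` along
  which the `s²`-coefficient of `per_4 (u + s y)` is, for every `u`, a sum of three weighted squares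
  of linear functionals (origin moments, isotropy defect `m - 17 ≤ 3`);
* `SymPencilBoxFourEquality.two_rows_or_two_cols` (val-width-5676-p2 g3): such a `V` is the block of
  matrices supported on two rows (or two columns);
* `SymPencilSdcSuperquadraticStubBlockRankFour.not_sum_three_sq_family` (val-width-5674-p1): on that
  block the `s²`-coefficient at a suitable `u` is a non-degenerate pairing of the two free rows, not
  of rank `≤ 3`.

Also recorded: the calibration window `21 ≤ sdc(per₄) ≤ 306` in the tree's
`symmDeterminantalComplexity` vocabulary (`sdc_perPoly_four_window_twentyOne`), and the statement in
the exact shape of the line's registered rung target `SdcPerFourTwentyOne` (`sdcPerFourTwentyOne`).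

HONEST FRAMING: a finite data point (`n = 4`: `+5` over the variable count); the crux
`SdcSuperquadratic` (`sdc(per_n) ≥ n^{2+ε}`, a bound past the number-of-variables wall) is not
touched, and nothing here bears on `VP ≠ VNP`.  The next size, `m = 21`, has a case `dim V = 7`
with defect `2` outside the reach of the BoxFour equality case. [folklore]
-/

noncomputable section

-- single-conjunct layout: Sub = Summit, duplicated namespace component intended
set_option linter.dupNamespace false

namespace Summit.ValiantsHypothesis.ValiantsHypothesis.Theorems.SymPencilSdcPerFourTwentyOne

open Matrix MvPolynomial Module
open Literature.Computability.AlgebraicComplexity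
open Summit.ValiantsHypothesis.ValiantsHypothesis.Theorems.SymPencilSdcSuperquadraticStubDefectForm
open Summit.ValiantsHypothesis.ValiantsHypothesis.Theorems.SymPencilSdcSuperquadraticStubBlockRankFour
open Summit.ValiantsHypothesis.ValiantsHypothesis.Theorems.SymPencilBoxFourEquality
open Summit.ValiantsHypothesis.ValiantsHypothesis.Theorems.SymPencilSdcPerThreeWindow
open Summit.ValiantsHypothesis.ValiantsHypothesis.Theorems.SymPencilSdcPerFourWindow

/-- **No symmetric affine determinantal representation of `per_4` has size `≤ 20`**
(characteristic `0`): the three stubs of the line `box_four` composed. [folklore] -/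
theorem false_of_isSymm_isAffineDetRepr_perPoly_four_le_twenty (K : Type*) [Field K] [CharZero K]
    {m : ℕ} (hm : m ≤ 20) {A : Matrix (Fin m) (Fin m) (MvPolynomial (Fin 4 × Fin 4) K)}
    (hS : A.IsSymm) (hA : IsAffineDetRepr (perPoly (Fin 4) K) A) : False := by
  obtain ⟨V, hV3, hV8, hform⟩ := defectForm_of_isSymm_isAffineDetRepr_perPoly_four_le K hm hS hA
  exact not_sum_three_sq_family V hV8 (two_rows_or_two_cols V hV3 hV8) hform

/-- **`sdc(per_4) ≥ 21`** over any field of characteristic `0`: a symmetric affine determinantal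
representation of `per_4` of size `m` has `21 ≤ m`. [folklore] -/
theorem twentyOne_le_of_isSymm_isAffineDetRepr_perPoly_four (K : Type*) [Field K] [CharZero K]
    {m : ℕ} {A : Matrix (Fin m) (Fin m) (MvPolynomial (Fin 4 × Fin 4) K)} (hS : A.IsSymm)
    (hA : IsAffineDetRepr (perPoly (Fin 4) K) A) : 21 ≤ m := by
  by_contra hlt
  exact false_of_isSymm_isAffineDetRepr_perPoly_four_le_twenty K (by omega) hS hA

/-- **`sdc(per_4) ≥ 4² + 5`** over `ℂ`, in the language of the route `SymPencil`: five more than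
the number of variables, in the symmetric model, for `n = 4`. [folklore] -/
theorem sq_add_five_le_of_isSymm_isAffineDetRepr_perPoly_four (m : ℕ)
    (A : Matrix (Fin m) (Fin m) (MvPolynomial (Fin 4 × Fin 4) ℂ)) (hS : A.IsSymm)
    (hA : IsAffineDetRepr (perPoly (Fin 4) ℂ) A) : 4 ^ 2 + 5 ≤ m :=
  twentyOne_le_of_isSymm_isAffineDetRepr_perPoly_four ℂ hS hA

/-- **The rung target of the line `box_four`**, in exactly the shape of the registered
`Cruxes.SdcSuperquadratic.BoxFour.SdcPerFourTwentyOne`: every symmetric affine determinantal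
representation of `per_4` over `ℂ` has size `≥ 21`. [folklore] -/
theorem sdcPerFourTwentyOne :
    ∀ (m : ℕ) (A : Matrix (Fin m) (Fin m) (MvPolynomial (Fin 4 × Fin 4) ℂ)), A.IsSymm →
      IsAffineDetRepr (perPoly (Fin 4) ℂ) A → 21 ≤ m :=
  fun _ _ hS hA => twentyOne_le_of_isSymm_isAffineDetRepr_perPoly_four ℂ hS hA

/-- **The window `21 ≤ sdc(per₄) ≤ 306`** over any field of characteristic `0`
(lower bound: this file; upper bound: Quarez, `SymPencilSdcPerFourWindow.sdc_perPoly_four_le`).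
[folklore] -/
theorem sdc_perPoly_four_window_twentyOne (K : Type*) [Field K] [CharZero K] :
    21 ≤ symmDeterminantalComplexity (perPoly (Fin 4) K) ∧
      symmDeterminantalComplexity (perPoly (Fin 4) K) ≤ 306 := by
  letI : Invertible (2 : K) := invertibleOfNonzero two_ne_zero
  refine ⟨?_, sdc_perPoly_four_le K two_ne_zero⟩
  obtain ⟨A, hS, hA⟩ :=
    hasSymmDetRepr_symmDeterminantalComplexity ⟨_, hasSymmDetRepr_perPoly_quarez K 4⟩
  exact twentyOne_le_of_isSymm_isAffineDetRepr_perPoly_four K hS hA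

/-- The complex instance: `21 ≤ sdc(per₄) ≤ 306` over `ℂ`. [folklore] -/
theorem sdc_perPoly_four_window_twentyOne_complex :
    21 ≤ symmDeterminantalComplexity (perPoly (Fin 4) ℂ) ∧
      symmDeterminantalComplexity (perPoly (Fin 4) ℂ) ≤ 306 :=
  sdc_perPoly_four_window_twentyOne ℂ

end Summit.ValiantsHypothesis.ValiantsHypothesis.Theorems.SymPencilSdcPerFourTwentyOne

end
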